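import Mathlib
import Summits.ResolutionOfSingularities.ResolutionOfSingularities.Theorems.WildQuotientsWildQuotientResolutionJordanFourChart0Subring
import Summits.ResolutionOfSingularities.ResolutionOfSingularities.Theorems.WildQuotientsWildQuotientResolutionToricExitRootChartFourFixed
import Summits.ResolutionOfSingularities.ResolutionOfSingularities.Theorems.WildQuotientsWildQuotientResolutionJordanFourTwistedChart

/-!
# V4U piece 0, B0-b (ii): `chart0_fixedPoints_eq` — the invariants of the `μ₃` root-chart action are the `⅓(1, p̄, 2)`-cone

(crux stmt-ResolutionOfSingularities-15640 `WildQuotients.WildQuotientResolution`, line `Sketch`,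
sector `|G| = p`; programme V4U of `L/w45c/CHAIN.md` v7.1 §4 row stub-1 (B0-b) and
`L/w45c/V4U-DESIGN.md` §2: «Γ(V₀)^σ = (U₀^Σ)^{weight 0} = adjoin k (Cone⅓(p̄) ∪ {d′} ∪ pass)»,
slot convention «(u₁,u₂,u₃) = (ρ, N, c′) if p ≡ 1 (mod 3), (N, c′, ρ) if p ≡ 2 (mod 3)».
[OURS · L1 W4.5c] — NOT a statement of any manuscript; replaces the role of no printed item.
Prover res-L1-w45c-stub-1.)

Root chart `U₀ = k[ρ, β, γ, δ, pass]` of the `μ₃`-vertex chart `D₊(x_a² t)` (slots `ρ = X a`,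
`β = X b`, `γ = X c`, `δ = X d`); the lifted `J₄` action `σ_U` (ABSTRACT by its law): `β ↦ β + ρ`,
`γ ↦ γ + ρβ`, `δ ↦ δ + ργ`, rest fixed. Invariants (res-L1-w45c-stub-1 gen 2, p489957/p490684):
`N = β^p − ρ^{p−1}β` (weight `p̄ = p mod 3`), `c′ = ½(2γ − β² + ρβ)` (weight `2`),
`d′ = δ − c′β − (β³ − 3ρβ² + 2ρ²β)/6` (weight `0`), and `U₀^{σ_U} ⊆ k[ρ, N, c′, d′, pass]`
(`ToricExit.mem_adjoin_of_rootChart4_eq`, `p ≥ 5`). The chart subring `S₀ ⊂ U₀` of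
`JordanFour.chart0_ringEquiv_adjoin` (p490009) is the `μ₃`-weight-`0` part
(`JordanFour.mem_adjoin_chart0Gens_iff`, B0-b (i) + B0-a).
* `chart0_fixedPoints_eq_map` (core): for the slot substitution
  `θ : X b ↦ N, X c ↦ c′, X d ↦ d′, X i ↦ X i` and ANY subalgebra `R` which is the weight-`0` part of
  a weight `w₁` with `w₁(a,b,c,d,pass) = (1, p̄, 2, 0, 0)`:
  `{f ∈ S₀ | σ_U f = f} = θ(R)` — route of V3U-C2: a fixed `f = θ P`; `θ` carries `w₁` to the
  `μ₃`-weight (`weightedHomogeneousComponent_aeval`), so an `S₀`-element is `θ` of the weight-`0`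
  part of `P`.
* `chart0_fixedPoints_eq_of_mod_three_eq_one` — `p ≡ 1 (mod 3)`: `R = (Third112.presentation k n a b c).range`
  (B0-a), i.e. the invariants are `k[Cone(ρ, N, c′), d′, pass]`.
* `chart0_fixedPoints_eq_of_mod_three_eq_two` — `p ≡ 2 (mod 3)`: `R = (Third112.presentation k n b c a).range`
  (weights `(1,2,2) = 2·(2,1,1)`, `isWeightedHomogeneous_zero_iff_of_mul`), i.e. `k[Cone(N, c′, ρ), d′, pass]`.
No algebraic independence of `ρ, N, c′, d′` is used.
-/

-- single-problem summit: the doubled namespace component `ResolutionOfSingularities` is forced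
set_option linter.dupNamespace false

noncomputable section

open MvPolynomial

namespace Summit.ResolutionOfSingularities.ResolutionOfSingularities.Theorems.WildQuotientResolution.JordanFour

variable (k : Type) [Field k] (n : ℕ)
  (σU : MvPolynomial (Fin n) k ≃ₐ[k] MvPolynomial (Fin n) k) (a b c d : Fin n)
  (hab : a ≠ b) (hac : a ≠ c) (had : a ≠ d) (hbc : b ≠ c) (hbd : b ≠ d) (hcd : c ≠ d)
  (hb : σU (X b) = X b + X a) (hc : σU (X c) = X c + X a * X b)
  (hd : σU (X d) = X d + X a * X c)
  (hσ : ∀ i, i ≠ b → i ≠ c → i ≠ d → σU (X i) = X i)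

include hab hac had hbc hbd hcd hb hc hd hσ in
/-- **B0-b core.** `{f ∈ S₀ | σ_U f = f} = θ(R)` for the slot substitution `θ` (`X b ↦ N`, `X c ↦ c′`,
`X d ↦ d′`, rest fixed) and any subalgebra `R` equal to the weight-`0` part of a weight `w₁` with
`w₁ a = 1`, `w₁ b = p`, `w₁ c = 2`, `w₁ = 0` elsewhere (`ZMod 3`-valued); `p ≥ 5`. [OURS · L1 W4.5c] -/
theorem chart0_fixedPoints_eq_map (p : ℕ) (hp : p.Prime) (hp5 : 5 ≤ p) [CharP k p]
    (w₁ : Fin n → ZMod 3) (hw₁a : w₁ a = 1) (hw₁b : w₁ b = (p : ZMod 3)) (hw₁c : w₁ c = 2)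
    (hw₁0 : ∀ i, i ≠ a → i ≠ b → i ≠ c → w₁ i = 0)
    (R : Subalgebra k (MvPolynomial (Fin n) k)) (hR : ∀ P, P ∈ R ↔ IsWeightedHomogeneous w₁ P 0) :
    {f : MvPolynomial (Fin n) k | f ∈ Algebra.adjoin k
        (Set.range (fun s : Fin n => MvPolynomial.aeval
            (fun s : Fin n => (if s = a then X a ^ 3 else
              X s * X a ^ (if s = b then 2 else if s = c then 1 else 0) : MvPolynomial (Fin n) k))
            (X s : MvPolynomial (Fin n) k)) ∪
          Set.range (![1, X a * X b ^ 2, X b * X c, X c ^ 3, X b ^ 3, X b ^ 2 * X c ^ 2,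
              X b * X c ^ 4, X c ^ 6] : Fin 8 → MvPolynomial (Fin n) k)) ∧ σU f = f} =
      (R.map (aeval (fun i : Fin n => if i = b then X b ^ p - X a ^ (p - 1) * X b
          else if i = c then C (2⁻¹ : k) * (2 * X c - X b ^ 2 + X a * X b)
          else if i = d then X d - (C (2⁻¹ : k) * (2 * X c - X b ^ 2 + X a * X b)) * X b -
            C (6⁻¹ : k) * (X b ^ 3 - 3 * (X a * X b ^ 2) + 2 * (X a ^ 2 * X b))
          else (X i : MvPolynomial (Fin n) k)) :
          MvPolynomial (Fin n) k →ₐ[k] MvPolynomial (Fin n) k) : Set (MvPolynomial (Fin n) k)) := by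
  classical
  haveI : Fact p.Prime := ⟨hp⟩
  have h2 : (2 : k) ≠ 0 := two_ne_zero_of_charP k p hp5
  have h3 : (3 : k) ≠ 0 := three_ne_zero_of_charP k p hp5
  have h6 : (6 : k) ≠ 0 := by
    rw [show (6 : k) = 2 * 3 by norm_num]; exact mul_ne_zero h2 h3
  have hp1 : p - 1 + 1 = p := Nat.sub_add_cancel hp.one_lt.le
  have ha : σU (X a) = X a := hσ a hab hac had
  -- the `μ₃`-weight and the chart subring
  set w₂ := Third112.coneWeight n a b c with hw₂
  have hw₂a : w₂ a = 1 := Third112.coneWeight_a a b c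
  have hw₂b : w₂ b = 1 := Third112.coneWeight_b a b c hab
  have hw₂c : w₂ c = 2 := Third112.coneWeight_c a b c hac hbc
  have hw₂0 : ∀ i, i ≠ a → i ≠ b → i ≠ c → w₂ i = 0 :=
    fun i hia hib hic => Third112.coneWeight_of_ne a b c i hia hib hic
  have hw₂d : w₂ d = 0 := hw₂0 d (Ne.symm had) (Ne.symm hbd) (Ne.symm hcd)
  have hS : ∀ f, f ∈ Algebra.adjoin k
      (Set.range (fun s : Fin n => MvPolynomial.aeval
          (fun s : Fin n => (if s = a then X a ^ 3 else
            X s * X a ^ (if s = b then 2 else if s = c then 1 else 0) : MvPolynomial (Fin n) k))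
          (X s : MvPolynomial (Fin n) k)) ∪
        Set.range (![1, X a * X b ^ 2, X b * X c, X c ^ 3, X b ^ 3, X b ^ 2 * X c ^ 2,
            X b * X c ^ 4, X c ^ 6] : Fin 8 → MvPolynomial (Fin n) k)) ↔
      IsWeightedHomogeneous w₂ f 0 := mem_adjoin_chart0Gens_iff k n a b c hab hbc hac
  -- the invariants `N, c′, d′` and the slot substitution `θ = aeval g`
  set N : MvPolynomial (Fin n) k := X b ^ p - X a ^ (p - 1) * X b with hN
  set c' : MvPolynomial (Fin n) k := C (2⁻¹ : k) * (2 * X c - X b ^ 2 + X a * X b) with hc'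
  set d' : MvPolynomial (Fin n) k := X d - c' * X b -
    C (6⁻¹ : k) * (X b ^ 3 - 3 * (X a * X b ^ 2) + 2 * (X a ^ 2 * X b)) with hd'
  let g : Fin n → MvPolynomial (Fin n) k := fun i =>
    if i = b then N else if i = c then c' else if i = d then d' else X i
  have hgb : g b = N := if_pos rfl
  have hgc : g c = c' := by
    change (if c = b then N else if c = c then c' else if c = d then d' else X c) = c'
    rw [if_neg (Ne.symm hbc), if_pos rfl]
  have hgd : g d = d' := by
    change (if d = b then N else if d = c then c' else if d = d then d' else X d) = d'
    rw [if_neg (Ne.symm hbd), if_neg (Ne.symm hcd), if_pos rfl]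
  have hgi : ∀ i, i ≠ b → i ≠ c → i ≠ d → g i = X i := by
    intro i hib hic hid
    change (if i = b then N else if i = c then c' else if i = d then d' else X i) = X i
    rw [if_neg hib, if_neg hic, if_neg hid]
  have hga : g a = X a := hgi a hab hac had
  -- `σ_U` fixes the images of `g`
  have hσN : σU N = N :=
    ToricExit.rootChart4_artinSchreier (σU : MvPolynomial (Fin n) k →+* MvPolynomial (Fin n) k)
      a b ha hb p
  have hσc' : σU c' = c' := ToricExit.rootChart4_half_gamma_invariant k n σU a b c d hab hac had hb hc hσ
  have hσd' : σU d' = d' := ToricExit.rootChart4_dPrime k n σU a b c d hab hac had hb hc hd hσ h2 h6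
  have hσg : ∀ i, σU (g i) = g i := by
    intro i
    by_cases hib : i = b
    · subst hib; rw [hgb, hσN]
    by_cases hic : i = c
    · subst hic; rw [hgc, hσc']
    by_cases hid : i = d
    · subst hid; rw [hgd, hσd']
    · rw [hgi i hib hic hid, hσ i hib hic hid]
  have hσθ : ∀ P : MvPolynomial (Fin n) k,
      σU ((aeval g : MvPolynomial (Fin n) k →ₐ[k] MvPolynomial (Fin n) k) P) =
        (aeval g : MvPolynomial (Fin n) k →ₐ[k] MvPolynomial (Fin n) k) P := by
    intro P
    have key : (σU : MvPolynomial (Fin n) k →ₐ[k] MvPolynomial (Fin n) k).comp (aeval g) = aeval g := by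
      refine MvPolynomial.algHom_ext fun i => ?_
      change σU (aeval g (X i)) = aeval g (X i)
      rw [aeval_X, hσg]
    exact congrArg (fun φ : MvPolynomial (Fin n) k →ₐ[k] MvPolynomial (Fin n) k => φ P) key
  -- weights of the images of `g`
  have hX : ∀ i (m : ZMod 3), w₂ i = m → IsWeightedHomogeneous w₂ (X i : MvPolynomial (Fin n) k) m := by
    intro i m him
    have h := isWeightedHomogeneous_X k w₂ i
    rwa [him] at h
  have hXa := hX a 1 hw₂a
  have hXb := hX b 1 hw₂b
  have hXc := hX c 2 hw₂c
  have hXd := hX d 0 hw₂d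
  have hNw : IsWeightedHomogeneous w₂ N (p : ZMod 3) := by
    have h1 : IsWeightedHomogeneous w₂ (X b ^ p : MvPolynomial (Fin n) k) (p : ZMod 3) := by
      have h := hXb.pow p
      rwa [nsmul_eq_mul, mul_one] at h
    have h2' : IsWeightedHomogeneous w₂ (X a ^ (p - 1) * X b : MvPolynomial (Fin n) k) (p : ZMod 3) := by
      have h := (hXa.pow (p - 1)).mul hXb
      rwa [nsmul_eq_mul, mul_one, ← Nat.cast_add_one, hp1] at h
    exact (weightedHomogeneousSubmodule k w₂ _).sub_mem h1 h2'
  have e3 : (1 : ZMod 3) + 1 + 1 = 0 := by decide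
  have e12 : (1 : ZMod 3) + 1 = 2 := by decide
  have e21 : (2 : ZMod 3) + 1 = 0 := by decide
  have hc'w : IsWeightedHomogeneous w₂ c' 2 := by
    have h2c : IsWeightedHomogeneous w₂ (2 * X c : MvPolynomial (Fin n) k) 2 := by
      have h := hXc.C_mul (2 : k)
      rwa [map_ofNat] at h
    have hbb : IsWeightedHomogeneous w₂ (X b ^ 2 : MvPolynomial (Fin n) k) 2 := by
      have h := hXb.mul hXb
      rwa [← sq, e12] at h
    have hab' : IsWeightedHomogeneous w₂ (X a * X b : MvPolynomial (Fin n) k) 2 := by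
      have h := hXa.mul hXb
      rwa [e12] at h
    exact (((weightedHomogeneousSubmodule k w₂ 2).sub_mem h2c hbb).add hab').C_mul (2⁻¹ : k)
  have hd'w : IsWeightedHomogeneous w₂ d' 0 := by
    have h1 : IsWeightedHomogeneous w₂ (c' * X b) 0 := by
      have h := hc'w.mul hXb
      rwa [e21] at h
    have hbbb : IsWeightedHomogeneous w₂ (X b ^ 3 : MvPolynomial (Fin n) k) 0 := by
      have h := (hXb.mul hXb).mul hXb
      rw [e3] at h
      have e : (X b ^ 3 : MvPolynomial (Fin n) k) = X b * X b * X b := by ring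
      rwa [e]
    have habb : IsWeightedHomogeneous w₂ (3 * (X a * X b ^ 2) : MvPolynomial (Fin n) k) 0 := by
      have e12' : (1 : ZMod 3) + 2 = 0 := by decide
      have h := ((hXa.mul (hXb.mul hXb))).C_mul (3 : k)
      rw [e12, e12', map_ofNat] at h
      have e : (3 * (X a * X b ^ 2) : MvPolynomial (Fin n) k) = 3 * (X a * (X b * X b)) := by ring
      rwa [e]
    have haab : IsWeightedHomogeneous w₂ (2 * (X a ^ 2 * X b) : MvPolynomial (Fin n) k) 0 := by
      have h := (((hXa.mul hXa).mul hXb)).C_mul (2 : k)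
      rw [e3, map_ofNat] at h
      have e : (2 * (X a ^ 2 * X b) : MvPolynomial (Fin n) k) = 2 * (X a * X a * X b) := by ring
      rwa [e]
    have hbr : IsWeightedHomogeneous w₂
        (X b ^ 3 - 3 * (X a * X b ^ 2) + 2 * (X a ^ 2 * X b) : MvPolynomial (Fin n) k) 0 :=
      ((weightedHomogeneousSubmodule k w₂ 0).sub_mem hbbb habb).add haab
    exact (weightedHomogeneousSubmodule k w₂ 0).sub_mem
      ((weightedHomogeneousSubmodule k w₂ 0).sub_mem hXd h1) (hbr.C_mul (6⁻¹ : k))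
  have hgw : ∀ i, IsWeightedHomogeneous w₂ (g i) (w₁ i) := by
    intro i
    by_cases hia : i = a
    · subst hia; rw [hga, hw₁a]; exact hXa
    by_cases hib : i = b
    · subst hib; rw [hgb, hw₁b]; exact hNw
    by_cases hic : i = c
    · subst hic; rw [hgc, hw₁c]; exact hc'w
    by_cases hid : i = d
    · subst hid; rw [hgd, hw₁0 i hia hib hic]; exact hd'w
    · rw [hgi i hib hic hid, hw₁0 i hia hib hic]
      exact hX i 0 (hw₂0 i hia hib hic)
  -- `k[N, c′, d′, X i (i ∉ {b,c,d})] ≤ range (aeval g)`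
  have hFle : Algebra.adjoin k (({X b ^ p - X a ^ (p - 1) * X b,
      C (2⁻¹ : k) * (2 * X c - X b ^ 2 + X a * X b),
      X d - (C (2⁻¹ : k) * (2 * X c - X b ^ 2 + X a * X b)) * X b -
        C (6⁻¹ : k) * (X b ^ 3 - 3 * (X a * X b ^ 2) + 2 * (X a ^ 2 * X b))} :
      Set (MvPolynomial (Fin n) k)) ∪ ((fun i => X i) '' {i | i ≠ b ∧ i ≠ c ∧ i ≠ d})) ≤
        (aeval g : MvPolynomial (Fin n) k →ₐ[k] MvPolynomial (Fin n) k).range := by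
    refine Algebra.adjoin_le ?_
    rintro x hx
    rcases hx with hx | ⟨i, ⟨hib, hic, hid⟩, rfl⟩
    · simp only [Set.mem_insert_iff, Set.mem_singleton_iff] at hx
      rcases hx with rfl | rfl | rfl
      · exact (AlgHom.mem_range _).mpr ⟨X b, by rw [aeval_X, hgb]⟩
      · exact (AlgHom.mem_range _).mpr ⟨X c, by rw [aeval_X, hgc]⟩
      · exact (AlgHom.mem_range _).mpr ⟨X d, by rw [aeval_X, hgd]⟩
    · exact (AlgHom.mem_range _).mpr ⟨X i, by rw [aeval_X, hgi i hib hic hid]⟩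
  apply Set.Subset.antisymm
  · -- `⊆`: a fixed `f ∈ S₀` is `θ` of the weight-`0` part of a preimage
    rintro f ⟨hfS, hfσ⟩
    have hf0 : IsWeightedHomogeneous w₂ f 0 := (hS f).mp hfS
    have hfF := ToricExit.mem_adjoin_of_rootChart4_eq k n σU a b c d hab hac had hbc hbd hcd hb hc hd hσ
      p hp hp5 f hfσ
    obtain ⟨P, hP⟩ := (AlgHom.mem_range _).mp (hFle hfF)
    have hcomp : f = aeval g (weightedHomogeneousComponent w₁ 0 P) := by
      rw [← weightedHomogeneousComponent_aeval w₁ w₂ g hgw P 0, hP]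
      exact (hf0.weightedHomogeneousComponent_same).symm
    rw [hcomp]
    exact Subalgebra.mem_map.mpr ⟨_, (hR _).mpr (weightedHomogeneousComponent_isWeightedHomogeneous 0 P), rfl⟩
  · -- `⊇`: `θ(R) ⊆ S₀` (weights) and `θ(R)` is fixed
    rintro f hf
    obtain ⟨P, hPR, rfl⟩ := Subalgebra.mem_map.mp hf
    refine ⟨(hS _).mpr ?_, hσθ P⟩
    exact ToricExit.isWeightedHomogeneous_aeval w₁ w₂ g hgw P 0 ((hR P).mp hPR)

/-- `p ≡ 1 (mod 3)`: `(p : ZMod 3) = 1`. [folklore] -/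
theorem natCast_zmod_three_of_mod_eq_one {p : ℕ} (h : p % 3 = 1) : (p : ZMod 3) = 1 := by
  have e := ZMod.natCast_mod p 3
  rw [h, Nat.cast_one] at e
  exact e.symm

/-- `p ≡ 2 (mod 3)`: `(p : ZMod 3) = 2`. [folklore] -/
theorem natCast_zmod_three_of_mod_eq_two {p : ℕ} (h : p % 3 = 2) : (p : ZMod 3) = 2 := by
  have e := ZMod.natCast_mod p 3
  rw [h] at e
  exact e.symm

include hab hac had hbc hbd hcd hb hc hd hσ in
/-- **B0-b, `p ≡ 1 (mod 3)`: `Γ(V₀)^σ = k[Cone(ρ, N, c′), d′, passengers]`** — the `σ_U`-invariants of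
the chart-`0` subring are the image of `(Third112.presentation k n a b c).range` under the slot
substitution `X b ↦ N, X c ↦ c′, X d ↦ d′` (`u₁ = ρ = X a`, `u₂ = N`, `u₃ = c′`). [OURS · L1 W4.5c] -/
theorem chart0_fixedPoints_eq_of_mod_three_eq_one (p : ℕ) (hp : p.Prime) (hp5 : 5 ≤ p) [CharP k p]
    (hp3 : p % 3 = 1) :
    {f : MvPolynomial (Fin n) k | f ∈ Algebra.adjoin k
        (Set.range (fun s : Fin n => MvPolynomial.aeval
            (fun s : Fin n => (if s = a then X a ^ 3 else
              X s * X a ^ (if s = b then 2 else if s = c then 1 else 0) : MvPolynomial (Fin n) k))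
            (X s : MvPolynomial (Fin n) k)) ∪
          Set.range (![1, X a * X b ^ 2, X b * X c, X c ^ 3, X b ^ 3, X b ^ 2 * X c ^ 2,
              X b * X c ^ 4, X c ^ 6] : Fin 8 → MvPolynomial (Fin n) k)) ∧ σU f = f} =
      ((Third112.presentation k n a b c).range.map
        (aeval (fun i : Fin n => if i = b then X b ^ p - X a ^ (p - 1) * X b
          else if i = c then C (2⁻¹ : k) * (2 * X c - X b ^ 2 + X a * X b)
          else if i = d then X d - (C (2⁻¹ : k) * (2 * X c - X b ^ 2 + X a * X b)) * X b -
            C (6⁻¹ : k) * (X b ^ 3 - 3 * (X a * X b ^ 2) + 2 * (X a ^ 2 * X b))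
          else (X i : MvPolynomial (Fin n) k)) :
          MvPolynomial (Fin n) k →ₐ[k] MvPolynomial (Fin n) k) : Set (MvPolynomial (Fin n) k)) :=
  chart0_fixedPoints_eq_map k n σU a b c d hab hac had hbc hbd hcd hb hc hd hσ p hp hp5
    (Third112.coneWeight n a b c) (Third112.coneWeight_a a b c)
    (by rw [Third112.coneWeight_b a b c hab, natCast_zmod_three_of_mod_eq_one hp3])
    (Third112.coneWeight_c a b c hac hbc) (fun i hia hib hic => Third112.coneWeight_of_ne a b c i hia hib hic)
    _ (Third112.mem_range_presentation_iff k n a b c hab hbc hac)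

include hab hac had hbc hbd hcd hb hc hd hσ in
/-- **B0-b, `p ≡ 2 (mod 3)`: `Γ(V₀)^σ = k[Cone(N, c′, ρ), d′, passengers]`** — the `σ_U`-invariants of
the chart-`0` subring are the image of `(Third112.presentation k n b c a).range` (the PERMUTED
triple `(u₁,u₂,u₃) = (N, c′, ρ)`, weights `(1,2,2) = 2·(2,1,1)`) under the same slot substitution.
[OURS · L1 W4.5c] -/
theorem chart0_fixedPoints_eq_of_mod_three_eq_two (p : ℕ) (hp : p.Prime) (hp5 : 5 ≤ p) [CharP k p]
    (hp3 : p % 3 = 2) :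
    {f : MvPolynomial (Fin n) k | f ∈ Algebra.adjoin k
        (Set.range (fun s : Fin n => MvPolynomial.aeval
            (fun s : Fin n => (if s = a then X a ^ 3 else
              X s * X a ^ (if s = b then 2 else if s = c then 1 else 0) : MvPolynomial (Fin n) k))
            (X s : MvPolynomial (Fin n) k)) ∪
          Set.range (![1, X a * X b ^ 2, X b * X c, X c ^ 3, X b ^ 3, X b ^ 2 * X c ^ 2,
              X b * X c ^ 4, X c ^ 6] : Fin 8 → MvPolynomial (Fin n) k)) ∧ σU f = f} =
      ((Third112.presentation k n b c a).range.map
        (aeval (fun i : Fin n => if i = b then X b ^ p - X a ^ (p - 1) * X b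
          else if i = c then C (2⁻¹ : k) * (2 * X c - X b ^ 2 + X a * X b)
          else if i = d then X d - (C (2⁻¹ : k) * (2 * X c - X b ^ 2 + X a * X b)) * X b -
            C (6⁻¹ : k) * (X b ^ 3 - 3 * (X a * X b ^ 2) + 2 * (X a ^ 2 * X b))
          else (X i : MvPolynomial (Fin n) k)) :
          MvPolynomial (Fin n) k →ₐ[k] MvPolynomial (Fin n) k) : Set (MvPolynomial (Fin n) k)) := by
  have hba : b ≠ a := fun h => hab h.symm
  have hca : c ≠ a := fun h => hac h.symm
  refine chart0_fixedPoints_eq_map k n σU a b c d hab hac had hbc hbd hcd hb hc hd hσ p hp hp5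
    (fun i => 2 * Third112.coneWeight n b c a i) ?_ ?_ ?_ ?_ _ ?_
  · rw [Third112.coneWeight_c b c a hba hca]; decide
  · rw [Third112.coneWeight_a b c a, natCast_zmod_three_of_mod_eq_two hp3]; decide
  · rw [Third112.coneWeight_b b c a hbc]; decide
  · intro i hia hib hic
    rw [Third112.coneWeight_of_ne b c a i hib hic hia, mul_zero]
  · intro P
    rw [Third112.mem_range_presentation_iff k n b c a hbc hca hba P]
    exact (isWeightedHomogeneous_zero_iff_of_mul (Third112.coneWeight n b c a) _ 2 2 (by decide)
      (fun i => rfl) P).symm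

end Summit.ResolutionOfSingularities.ResolutionOfSingularities.Theorems.WildQuotientResolution.JordanFour

end
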